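import Summits.ValiantsHypothesis.ValiantsHypothesis.Theorems.BarrierLeverAnchoredDoorHitsLowerPairsSplitGeneralLimit

/-!
# Support item `AnchoredDoorHitsLowerPairs` (stmt-ValiantsHypothesis-22510), line `anchored-peeling`:
# CONJECTURE SP IS A THEOREM FOR EVERY `m` — the registered stub `stub_splitFamilyGe3` (and `Stmt.stub_splitFamily` for all `m ≥ 1`)

Final file of the chain `…SplitGeneral{Zeon, Core, Design, DesignTop, Rows, RowsConv, Faces, RowSums, Limit}` (`--supports stmt-ValiantsHypothesis-22510`;
cell valiant-natproofs, rung V4, 𝒟-side door (c); registered line `Cruxes/AnchoredDoorHitsLowerPairs/Lines/anchored_peeling.lean` v24; prover seat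
val-np-p1 gen 24; memo HOME/val-np-p1/g24/MEMO-SP-proof-valnp1-g24.md).

THEOREM (`splitFamily_all`). For every `m ≥ 1`, every ambient `h` with `2m+2 ≤ h`, `2^{m+1}+2^m−1 ≤ h`, and every pair of injective enumerations `(u, w)`
of the split pair `S_m = (cube_{2m+2}, K_{2^{m+1}} ∨ I_{2^m−1})` (`SplitRow m h`, `SplitCol m h`), the profile-1 symbolic minor is nonzero:
`symbolicDet 1 h r u w ≠ 0`. Hence `theorem stub_splitFamilyGe3 : Stmt.stub_splitFamilyGe3` (the REGISTERED stub, `3 ≤ m`, text verbatim from the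
skeleton) and `theorem stub_splitFamily : Stmt.stub_splitFamily` (`…SplitFamily`, every `m ≥ 1`).

PROOF (memo §3). Doors = the design `𝒟(L₀)` (`thetaN`/`phiN` read through `Fin.val`) at a suitable complex scale `L₀`: the door layout matrix is the
evaluation at `L₀` of a polynomial matrix whose entries have column-wise degree bounds with top coefficients = the LIMIT design; the top coefficient of its
determinant is the determinant of the limit layout (`coeff_det_of_natDegree_le`), which is nonzero because the limit columns are independent
(`topCol_indep`, via `Matrix.exists_mulVec_eq_zero_iff`); a nonzero complex polynomial has a non-root `L₀`; conclude with `symbolicDet_one_ne_zero_of_doorDet`.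
Nothing here uses a particular enumeration: rows and columns are handled through their value codes.

WHAT THIS IS NOT: the composition of record of the line still needs `stub_ltRestNonCanonRS`; nothing on crux stmt-ValiantsHypothesis-14610 or on `VP` versus `VNP`.
-/

set_option linter.dupNamespace false

namespace Summit.ValiantsHypothesis.ValiantsHypothesis.Theorems.BarrierLever.AnchoredPeeling

namespace SplitGeneral

open Finset DecFamily Polynomial MvPolynomial
open Summit.ValiantsHypothesis.ValiantsHypothesis.Theorems.BarrierLever.BrickCalculus (pexpo)

variable {m : ℕ}

/-! ## 1. Columns of the design as polynomials in the scale -/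

section Col

variable {R : Type*} [CommRing R]

/-- The column of the face `E` (by value) of the design at scale `L`: delta of `∅`, a door, or the convolution of two doors. -/
def colR (m : ℕ) (L : R) (E C : Finset ℕ) : R :=
  if h : E.Nonempty then
    (if E.card = 1 then doorFunN (thetaN m L) (phiN m L) (E.min' h) C
     else conv (doorFunN (thetaN m L) (phiN m L) (E.min' h)) (doorFunN (thetaN m L) (phiN m L) (E.max' h)) C)
  else (if C = ∅ then 1 else 0)

/-- Ring maps act on columns through the scale. -/
theorem map_colR {S : Type*} [CommRing S] (ψ : R →+* S) (m : ℕ) (L : R) (E C : Finset ℕ) :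
    ψ (colR m L E C) = colR m (ψ L) E C := by
  unfold colR
  split_ifs
  · exact map_doorFunN_design ψ m L _ C
  · rw [map_conv]
    congr 1 <;> funext V <;> exact map_doorFunN_design ψ m L _ V
  · simp
  · simp

end Col

/-- The column degree of a face. -/
def dcol (m : ℕ) (E : Finset ℕ) : ℕ := ∑ y ∈ E, dgN m y

/-- **Degree bound and top coefficient of a column** (faces of size ≤ 2). -/
theorem colR_top (E : Finset ℕ) (hE : E.card ≤ 2) (C : Finset ℕ) :
    (colR m (X : ℂ[X]) E C).natDegree ≤ dcol m E ∧ (colR m (X : ℂ[X]) E C).coeff (dcol m E) = topCol m E C := by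
  classical
  unfold colR topCol dcol
  by_cases h : E.Nonempty
  · rw [dif_pos h, dif_pos h]
    by_cases h1 : E.card = 1
    · obtain ⟨y, rfl⟩ := Finset.card_eq_one.mp h1
      rw [if_pos (Finset.card_singleton y), if_pos (Finset.card_singleton y), Finset.min'_singleton, Finset.sum_singleton]
      exact ⟨natDegree_doorFunN_le m y C, coeff_doorFunN_top m y C⟩
    · have h2 : E.card = 2 := by have := Finset.card_pos.mpr h; omega
      obtain ⟨a, b, hab, rfl⟩ := Finset.card_eq_two.mp h2
      rw [if_neg h1, if_neg h1, Finset.sum_pair hab]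
      set y := ({a, b} : Finset ℕ).min' h
      set y' := ({a, b} : Finset ℕ).max' h
      have hyy : dgN m a + dgN m b = dgN m y + dgN m y' := by
        rcases lt_or_gt_of_ne hab with hlt | hgt
        · have hy : y = a := le_antisymm (Finset.min'_le _ _ (by simp)) (Finset.le_min' _ _ _ (fun z hz => by
            rcases Finset.mem_insert.mp hz with rfl | hz; · exact le_rfl
            · rw [Finset.mem_singleton.mp hz]; exact hlt.le))
          have hy' : y' = b := le_antisymm (Finset.max'_le _ _ _ (fun z hz => by
            rcases Finset.mem_insert.mp hz with rfl | hz; · exact hlt.le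
            · rw [Finset.mem_singleton.mp hz])) (Finset.le_max' _ _ (by simp))
          rw [hy, hy']
        · have hy : y = b := le_antisymm (Finset.min'_le _ _ (by simp)) (Finset.le_min' _ _ _ (fun z hz => by
            rcases Finset.mem_insert.mp hz with rfl | hz; · exact hgt.le
            · rw [Finset.mem_singleton.mp hz]))
          have hy' : y' = a := le_antisymm (Finset.max'_le _ _ _ (fun z hz => by
            rcases Finset.mem_insert.mp hz with rfl | hz; · exact le_rfl
            · rw [Finset.mem_singleton.mp hz]; exact hgt.le)) (Finset.le_max' _ _ (by simp))
          rw [hy, hy', add_comm]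
      rw [hyy]
      exact ⟨natDegree_conv_le _ _ _ _ (natDegree_doorFunN_le m y) (natDegree_doorFunN_le m y') C,
        coeff_conv_top _ _ _ _ (natDegree_doorFunN_le m y) (natDegree_doorFunN_le m y') C |>.trans
          (by congr 1 <;> funext V <;> exact coeff_doorFunN_top m _ V)⟩
  · rw [dif_neg h, dif_neg h, Finset.not_nonempty_iff_eq_empty.mp h, Finset.sum_empty]
    unfold ind
    by_cases hC : C = ∅
    · simp [hC]
    · simp [hC]

/-! ## 2. The door layout of the design in `Fin h` coordinates -/

section Layout

variable {h : ℕ}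

/-- Root weights of `𝒟(L₀)` on `Fin h`. -/
def thetaF (m : ℕ) (L₀ : ℂ) : Fin h → Fin h → ℂ := fun b y => thetaN m L₀ b.val y.val

/-- Tails of `𝒟(L₀)` on `Fin h`. -/
def phiF (m : ℕ) (L₀ : ℂ) : Fin h → Fin h → Fin h → ℂ := fun b y b' => phiN m L₀ b.val y.val b'.val

/-- The door coefficient function on `Fin h` is the value-coded one. -/
theorem doorFun_eq_doorFunN (L₀ : ℂ) (y : Fin h) (U : Finset (Fin h)) :
    doorFun (thetaF m L₀) (phiF m L₀) y U = doorFunN (thetaN m L₀) (phiN m L₀) y.val (U.image Fin.val) := by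
  classical
  unfold doorFun doorFunN thetaF phiF
  rw [Finset.sum_image (fun b _ b' _ hbb => Fin.ext hbb)]
  refine Finset.sum_congr rfl (fun b hb => ?_)
  congr 1
  rw [← Finset.image_erase Fin.val_injective, Finset.prod_image (fun b _ b' _ hbb => Fin.ext hbb)]

/-- **Entries of the door layout of `𝒟(L₀)` are the value-coded columns.** -/
theorem coeff_prod_doorElem_eq_colR (L₀ : ℂ) (W : Finset (Fin h)) (hW : W.card ≤ 2) (U : Finset (Fin h)) :
    MvPolynomial.coeff (pexpo U ∅) (∏ y ∈ W, doorElem (thetaF m L₀) (phiF m L₀) y) = colR m L₀ (W.image Fin.val) (U.image Fin.val) := by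
  classical
  unfold colR
  by_cases h0 : W = ∅
  · subst h0
    rw [Finset.prod_empty, coeff_pexpo_one', Finset.image_empty, dif_neg Finset.not_nonempty_empty]
    by_cases hU : U = ∅
    · rw [if_pos hU, if_pos (by rw [hU, Finset.image_empty])]
    · rw [if_neg hU, if_neg (fun h => hU (Finset.image_eq_empty.mp h))]
  have hWn : (W.image Fin.val).Nonempty := Finset.image_nonempty.mpr (Finset.nonempty_iff_ne_empty.mpr h0)
  rw [dif_pos hWn]
  by_cases h1 : W.card = 1
  · obtain ⟨y, rfl⟩ := Finset.card_eq_one.mp h1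
    rw [Finset.prod_singleton, coeff_pexpo_doorElem, doorFun_eq_doorFunN]
    rw [if_pos (by rw [Finset.image_singleton, Finset.card_singleton])]
    congr 1
  · have h2 : W.card = 2 := by have := Finset.card_pos.mpr (Finset.nonempty_iff_ne_empty.mpr h0); omega
    obtain ⟨a, b, hab, rfl⟩ := Finset.card_eq_two.mp h2
    have hvab : a.val ≠ b.val := fun h => hab (Fin.ext h)
    have himg : (({a, b} : Finset (Fin h)).image Fin.val) = {a.val, b.val} := by simp [Finset.image_insert]
    rw [coeff_pexpo_prod_doorElem_pair _ _ hab, if_neg (by rw [himg, Finset.card_pair hvab]; norm_num)]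
    have hconv : conv (doorFun (thetaF m L₀) (phiF m L₀) a) (doorFun (thetaF m L₀) (phiF m L₀) b) U =
        conv (doorFunN (thetaN m L₀) (phiN m L₀) a.val) (doorFunN (thetaN m L₀) (phiN m L₀) b.val) (U.image Fin.val) := by
      rw [conv_image Fin.val Fin.val_injective]
      unfold conv
      exact Finset.sum_congr rfl (fun V _ => by rw [doorFun_eq_doorFunN, doorFun_eq_doorFunN])
    rw [hconv]
    -- identify `min'`/`max'` of `{a.val, b.val}`
    have key : ∀ (x y : ℕ), x < y → ∀ (hn : ({x, y} : Finset ℕ).Nonempty), ({x, y} : Finset ℕ).min' hn = x ∧ ({x, y} : Finset ℕ).max' hn = y := by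
      intro x y hxy hn
      exact ⟨le_antisymm (Finset.min'_le _ _ (by simp)) (Finset.le_min' _ _ _ (fun z hz => by
          rcases Finset.mem_insert.mp hz with rfl | hz; · exact le_rfl
          · rw [Finset.mem_singleton.mp hz]; exact hxy.le)),
        le_antisymm (Finset.max'_le _ _ _ (fun z hz => by
          rcases Finset.mem_insert.mp hz with rfl | hz; · exact hxy.le
          · rw [Finset.mem_singleton.mp hz])) (Finset.le_max' _ _ (by simp))⟩
    have hWn' : (({a.val, b.val} : Finset ℕ)).Nonempty := Finset.insert_nonempty _ _
    have hmm : ∀ (hn : (({a, b} : Finset (Fin h)).image Fin.val).Nonempty),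
        (conv (doorFunN (thetaN m L₀) (phiN m L₀) ((({a, b} : Finset (Fin h)).image Fin.val).min' hn))
          (doorFunN (thetaN m L₀) (phiN m L₀) ((({a, b} : Finset (Fin h)).image Fin.val).max' hn)) (U.image Fin.val)) =
        conv (doorFunN (thetaN m L₀) (phiN m L₀) a.val) (doorFunN (thetaN m L₀) (phiN m L₀) b.val) (U.image Fin.val) := by
      rw [himg]
      intro hn
      rcases lt_or_gt_of_ne hvab with hlt | hgt
      · obtain ⟨h1, h2⟩ := key _ _ hlt hn; rw [h1, h2]
      · have e1 : ({a.val, b.val} : Finset ℕ).min' hn = b.val :=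
          le_antisymm (Finset.min'_le _ _ (by simp)) (Finset.le_min' _ _ _ (fun z hz => by
            rcases Finset.mem_insert.mp hz with rfl | hz; · exact hgt.le
            · rw [Finset.mem_singleton.mp hz]))
        have e2 : ({a.val, b.val} : Finset ℕ).max' hn = a.val :=
          le_antisymm (Finset.max'_le _ _ _ (fun z hz => by
            rcases Finset.mem_insert.mp hz with rfl | hz; · exact le_rfl
            · rw [Finset.mem_singleton.mp hz]; exact hgt.le)) (Finset.le_max' _ _ (by simp))
        rw [e1, e2, conv_comm]
    exact (hmm hWn).symm

end Layout

/-! ## 3. Rows and columns by value -/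

section Codes

variable {h : ℕ}

/-- A row of the split pair codes to a face of the `(2m+2)`-cube. -/
theorem image_val_subset_of_splitRow {U : Finset (Fin h)} (hU : SplitRow m h U) : U.image Fin.val ⊆ range (2 * m + 2) := by
  intro v hv
  obtain ⟨x, hx, rfl⟩ := Finset.mem_image.mp hv
  exact Finset.mem_range.mpr (by have := hU x hx; omega)

/-- Every face of the `(2m+2)`-cube is the code of a row. -/
theorem exists_splitRow_of_subset (hh : 2 * m + 2 ≤ h) {C : Finset ℕ} (hC : C ⊆ range (2 * m + 2)) :
    ∃ U : Finset (Fin h), SplitRow m h U ∧ U.image Fin.val = C := by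
  classical
  refine ⟨Finset.univ.filter (fun x : Fin h => x.val ∈ C), fun x hx => ?_, ?_⟩
  · have := Finset.mem_range.mp (hC (Finset.mem_filter.mp hx).2); omega
  · ext v
    rw [Finset.mem_image]
    constructor
    · rintro ⟨x, hx, rfl⟩; exact (Finset.mem_filter.mp hx).2
    · intro hv
      have hvh : v < h := by have := Finset.mem_range.mp (hC hv); omega
      exact ⟨⟨v, hvh⟩, Finset.mem_filter.mpr ⟨Finset.mem_univ _, hv⟩, rfl⟩

/-- A column of the split pair codes to a face of the split graph. -/
theorem image_val_mem_codeFaces {W : Finset (Fin h)} (hW : SplitCol m h W) : W.image Fin.val ∈ codeFaces m := by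
  classical
  obtain ⟨hlt, hcard, hind⟩ := hW
  refine mem_codeFaces.mpr ⟨fun v hv => ?_, (Finset.card_image_le).trans hcard, fun y hy y' hy' h1 h2 => ?_⟩
  · obtain ⟨x, hx, rfl⟩ := Finset.mem_image.mp hv
    exact Finset.mem_range.mpr (by have := hlt x hx; omega)
  · obtain ⟨x, hx, rfl⟩ := Finset.mem_image.mp hy
    obtain ⟨x', hx', rfl⟩ := Finset.mem_image.mp hy'
    rw [hind x hx x' hx' h1 h2]

end Codes

/-! ## 4. The main theorem -/

section Main

variable {r : ℕ}

/-- **The limit layout is nonsingular** (columns coded injectively into faces, rows exhausting the cube). -/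
theorem det_top_ne_zero (cU cW : Fin r → Finset ℕ) (hcW : ∀ j, cW j ∈ codeFaces m) (hinj : Function.Injective cW)
    (hrows : ∀ (S T : Finset ℕ) (e : Bool), S ⊆ range (m + 1) → T ⊆ range m → ∃ i, cU i = rowC m S e T) :
    (Matrix.of fun i j : Fin r => topCol m (cW j) (cU i)).det ≠ 0 := by
  classical
  intro hdet
  obtain ⟨v, hv0, hv⟩ := Matrix.exists_mulVec_eq_zero_iff.mpr hdet
  let g : Finset ℕ → ℂ := fun E => ∑ j ∈ Finset.univ.filter (fun j => cW j = E), v j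
  have hgw : ∀ j, g (cW j) = v j := by
    intro j
    show ∑ j' ∈ Finset.univ.filter (fun j' => cW j' = cW j), v j' = v j
    rw [Finset.sum_eq_single j (fun j' hj' hne => absurd (hinj (Finset.mem_filter.mp hj').2) hne)
      (fun hj => absurd (Finset.mem_filter.mpr ⟨Finset.mem_univ j, (rfl : cW j = cW j)⟩) hj)]
  have hsum : ∀ C : Finset ℕ, ∑ E ∈ codeFaces m, g E * topCol m E C = ∑ j, v j * topCol m (cW j) C := by
    intro C
    rw [← Finset.sum_fiberwise_of_maps_to (s := Finset.univ) (t := codeFaces m) (g := cW) (fun j _ => hcW j)]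
    refine Finset.sum_congr rfl (fun E _ => ?_)
    rw [Finset.sum_mul]
    exact Finset.sum_congr rfl (fun j hj => by rw [(Finset.mem_filter.mp hj).2])
  have hg : ∀ (S T : Finset ℕ) (e : Bool), S ⊆ range (m + 1) → T ⊆ range m →
      ∑ E ∈ codeFaces m, g E * topCol m E (rowC m S e T) = 0 := by
    intro S T e hS hT
    obtain ⟨i, hi⟩ := hrows S T e hS hT
    rw [hsum, ← hi]
    have := congrFun hv i
    rw [Pi.zero_apply] at this
    rw [← this, Matrix.mulVec, dotProduct]
    exact Finset.sum_congr rfl (fun j _ => by simp only [Matrix.of_apply, mul_comm])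
  have hz := topCol_indep g hg
  apply hv0
  funext j
  rw [Pi.zero_apply, ← hgw j]
  exact hz _ (hcW j)

/-- **The polynomial layout has nonzero determinant** (its top coefficient is the limit determinant). -/
theorem det_colR_ne_zero (cU cW : Fin r → Finset ℕ) (hcW : ∀ j, cW j ∈ codeFaces m) (hinj : Function.Injective cW)
    (hrows : ∀ (S T : Finset ℕ) (e : Bool), S ⊆ range (m + 1) → T ⊆ range m → ∃ i, cU i = rowC m S e T) :
    (Matrix.of fun i j : Fin r => colR m (X : ℂ[X]) (cW j) (cU i)).det ≠ 0 := by
  classical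
  have hcard : ∀ j, (cW j).card ≤ 2 := fun j => (mem_codeFaces.mp (hcW j)).2.1
  intro hdet
  have hc := coeff_det_of_natDegree_le (Matrix.of fun i j : Fin r => colR m (X : ℂ[X]) (cW j) (cU i)) (fun j => dcol m (cW j))
    (fun i j => by rw [Matrix.of_apply]; exact (colR_top (cW j) (hcard j) (cU i)).1)
  rw [hdet, Polynomial.coeff_zero] at hc
  apply det_top_ne_zero cU cW hcW hinj hrows
  rw [← hc.symm]
  congr 1
  ext i j
  rw [Matrix.of_apply, Matrix.of_apply, Matrix.of_apply]
  exact ((colR_top (cW j) (hcard j) (cU i)).2).symm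

/-- **A good scale exists**: some `L₀ ∈ ℂ` makes the layout of `𝒟(L₀)` nonsingular. -/
theorem exists_scale (cU cW : Fin r → Finset ℕ) (hcW : ∀ j, cW j ∈ codeFaces m) (hinj : Function.Injective cW)
    (hrows : ∀ (S T : Finset ℕ) (e : Bool), S ⊆ range (m + 1) → T ⊆ range m → ∃ i, cU i = rowC m S e T) :
    ∃ L₀ : ℂ, (Matrix.of fun i j : Fin r => colR m L₀ (cW j) (cU i)).det ≠ 0 := by
  classical
  have hMX := det_colR_ne_zero cU cW hcW hinj hrows
  obtain ⟨L₀, hL₀⟩ : ∃ L₀ : ℂ, ((Matrix.of fun i j : Fin r => colR m (X : ℂ[X]) (cW j) (cU i)).det).eval L₀ ≠ 0 := by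
    by_contra hall
    push Not at hall
    exact hMX (Polynomial.zero_of_eval_zero _ hall)
  refine ⟨L₀, ?_⟩
  have hmat : (Matrix.of fun i j : Fin r => colR m L₀ (cW j) (cU i)) =
      (Polynomial.evalRingHom L₀).mapMatrix (Matrix.of fun i j : Fin r => colR m (X : ℂ[X]) (cW j) (cU i)) := by
    ext i j
    rw [Matrix.of_apply, RingHom.mapMatrix_apply, Matrix.map_apply, Matrix.of_apply, map_colR, Polynomial.coe_evalRingHom, Polynomial.eval_X]
  rw [hmat, ← RingHom.map_det]
  exact hL₀

end Main

/-- **CONJECTURE SP for every `m`: the split pair is hit at profile 1, for every ambient size and every pair of injective enumerations.** -/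
theorem splitFamily_all (m h r : ℕ) (u w : Fin r → Finset (Fin h)) (hh : 2 * m + 2 ≤ h)
    (hw : Function.Injective w)
    (hU : ∀ U : Finset (Fin h), U ∈ Set.range u ↔ SplitRow m h U) (hW : ∀ W : Finset (Fin h), W ∈ Set.range w ↔ SplitCol m h W) :
    symbolicDet 1 h r u w ≠ 0 := by
  classical
  have hcol : ∀ j, SplitCol m h (w j) := fun j => (hW (w j)).mp ⟨j, rfl⟩
  have hcW : ∀ j, (w j).image Fin.val ∈ codeFaces m := fun j => image_val_mem_codeFaces (hcol j)
  have hinj : Function.Injective (fun j => (w j).image Fin.val) := fun j j' hjj => hw (Finset.image_injective Fin.val_injective hjj)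
  have hrows : ∀ (S T : Finset ℕ) (e : Bool), S ⊆ range (m + 1) → T ⊆ range m → ∃ i, (u i).image Fin.val = rowC m S e T := by
    intro S T e hS hT
    obtain ⟨U, hUrow, hUC⟩ := exists_splitRow_of_subset hh (rowC_subset_range hS hT e)
    obtain ⟨i, rfl⟩ := (hU U).mpr hUrow
    exact ⟨i, hUC⟩
  obtain ⟨L₀, hL₀⟩ := exists_scale (fun i => (u i).image Fin.val) (fun j => (w j).image Fin.val) hcW hinj hrows
  refine symbolicDet_one_ne_zero_of_doorDet u w ⟨thetaF m L₀, phiF m L₀, ?_⟩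
  have hmat : (Matrix.of fun i j : Fin r => MvPolynomial.coeff (pexpo (u i) ∅) (∏ γ ∈ w j, doorElem (thetaF m L₀) (phiF m L₀) γ)) =
      Matrix.of fun i j : Fin r => colR m L₀ ((w j).image Fin.val) ((u i).image Fin.val) := by
    ext i j
    rw [Matrix.of_apply, Matrix.of_apply]
    exact coeff_prod_doorElem_eq_colR L₀ (w j) (hcol j).2.1 (u i)
  rw [hmat]
  exact hL₀

end SplitGeneral

/-! ## 5. The registered stub, by name -/

/-- **STUB TEXT (v24) `stub_splitFamilyGe3` = CONJECTURE SP for `m ≥ 3`** (verbatim from the registered skeleton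
`Cruxes/AnchoredDoorHitsLowerPairs/Lines/anchored_peeling.lean` v24): every injective enumeration of the split family at level `m ≥ 3` is hit at profile 1. -/
def Stmt.stub_splitFamilyGe3 : Prop :=
  ∀ (m h r : ℕ) (u w : Fin r → Finset (Fin h)), 3 ≤ m → 2 * m + 2 ≤ h → 2 ^ (m + 1) + 2 ^ m - 1 ≤ h →
    Function.Injective u → Function.Injective w →
    (∀ U : Finset (Fin h), U ∈ Set.range u ↔ Summit.ValiantsHypothesis.ValiantsHypothesis.Theorems.BarrierLever.AnchoredPeeling.SplitRow m h U) → (∀ W : Finset (Fin h), W ∈ Set.range w ↔ Summit.ValiantsHypothesis.ValiantsHypothesis.Theorems.BarrierLever.AnchoredPeeling.SplitCol m h W) →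
    symbolicDet 1 h r u w ≠ 0

/-- **CONJECTURE SP IS A THEOREM — the registered stub `stub_splitFamilyGe3` of line `anchored_peeling` v24, by name.** -/
theorem stub_splitFamilyGe3 : Stmt.stub_splitFamilyGe3 :=
  fun m h r u w _ hh _ _ hw hU hW => SplitGeneral.splitFamily_all m h r u w hh hw hU hW

/-- **CONJECTURE SP (the v23 text `Stmt.stub_splitFamily` of `…SplitFamily`, every `m ≥ 1`) IS A THEOREM.** -/
theorem stub_splitFamily : Stmt.stub_splitFamily :=
  fun m h r u w _ hh _ _ hw hU hW => SplitGeneral.splitFamily_all m h r u w hh hw hU hW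

end Summit.ValiantsHypothesis.ValiantsHypothesis.Theorems.BarrierLever.AnchoredPeeling
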